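import Literature.IUT.HodgeTheaters.FrobenioidBridgeEx54ivInfKappaArithTransport
import Literature.IUT.HodgeTheaters.FrobenioidBridgeEx54ivInfKappaArithLink
import Literature.IUT.HodgeTheaters.KappaCoricRatGaloisCritLocusGeomProofs
import Literature.IUT.HodgeTheaters.InitialThetaDataCurveModelLocal
import Literature.AnabelianGeometry.AbsoluteAnabelian.FundamentalExtensionRestrictionConj
import HarnessLib

/-!
# [IUTchI] Example 5.1 (i) / Example 5.4 (iv): the `∞κ`-coric structure TRANSPORTED to the Thm-1.9-presented
# closure `Λ_A`, its identification with the model carrier `𝕄_{∞κ}(Λ_F)`, the `Π_{C_F}`-action on `K_A`, and the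
# residual `ReconEquivariant` (typed only) — GAP B = G-L5t9g8-1, item GB-09, companion of
# `FrobenioidBridgeEx54ivInfKappaArithTransport.lean`

S. Mochizuki, *Inter-universal Teichmüller theory I*, kurims manuscript (May 2020), Example 5.1 (i) pp. 123–124
(«natural isomorphs `𝕄^⊛_∞κ(†𝒟^⊚)` … of the pseudo-monoids of `∞κ`-coric rational functions associated to `C_{F_mod}` …
equipped with natural `π₁^{rat}(†𝒟^⊛)`-actions»), Example 5.4 (iv) p. 149, Remark 3.1.7 (i)(ii) pp. 66–67;
S. Mochizuki, *Topics in Absolute Anabelian Geometry III*, Thm 1.9 p. 37–38 («functorial group-theoretic algorithm»).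
([IUTchI] Ex 5.1 (i) p.124) [claim: Mochizuki2012, status: disputed] (D-0012 claim key; THIS file is elementary
field theory at OUR typed objects; nothing disputed is used; no side taken on [IUTchIII] Cor. 3.12).

## What this file builds (`GAP-SIZING-B.md` 2de24246389ab103 §2 row D9; RULINGS #342 (A) / #343 (A)(C) of abc-iut-L5-lead:
## «GB-09 = objects + identification + group/continuity, NO equivariance claim; `ReconEquivariant` TYPED, asserted by
## nobody; C2-facing statements over `(R : D.ReconRatObjects)`; state at `D.nfCurveModelLocal G` or project from it»)

For `R : D.ReconRatObjects` (file 1; `e_A = D.reconIdentification R : Λ_A ≃+* Λ_F`, `ρ_A = D.reconRatGalEquiv R`):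
* PROJECTIONS of the binder: `D.reconRatObjectsOfPoints N h`, `D.reconRatObjectsOfLocal G h` — the convenience
  witnesses from `Thm_1_9` at the points-ENRICHED models `D.nfCurveModelOfPoints N` / `D.nfCurveModelLocal G` (GB-13
  ★: `thm_1_9_nfCurveModel_of_points`, `thm_1_9_nfCurveModel_of_local`), OFF the statement path (#343 (A)(2));
* `R.act g : K_A ≃+* K_A` — the action of `g ∈ Π_{C_F}` on the Thm-1.9 output through the algorithm's TRANSPORT `A.map`
  along the inner isomorphism `innerIso g` of the extension (the typed functoriality (t1) of `NFPortionAlgorithm`);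
* **`D.ReconEquivariant R : Prop`** — TYPED ONLY, ASSERTED BY NOBODY (#342 (A)): «`φ_A (g · x) = (φ_A x)^{aug g}`», the
  compatibility of that `Π_{C_F}`-action with the coefficient action of `G_F` on `F̄(t)` through the chosen `φ_A`;
* `R.geomAlgebra` — the `F̄(t)`-algebra structure `F̄(t) ≅ K_A → Λ_A` (through `φ_A⁻¹`; a `def`, bind with `letI`);
  **`R.infKappaSet ⊆ Λ_A`** := GB-01's `CriticalLocus.infKappaCoricSetIn` BY NAME at GB-04's GEOMETRIC locus
  `D.critLocusGeom : CriticalLocus Fbar` BY NAME for that structure — the `∞κ`-coric elements of `Λ_A`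
  (divisors counted over `F̄`, RULINGS #318); `0 ∉`, `1 ∈`, NON-VACUOUS beyond constants (GB-04's Rmk 3.1.7 (ii) witness);
* **identification theorem** `R.reconIdentification_mem_minfkSet_iff : e_A x ∈ D.critLocus.minfkSet ↔ x ∈ R.infKappaSet`
  — the transported structure IS GB-02's model carrier `𝕄_{∞κ}(Λ_F)` (design (B): `minfkSet` over `geomConstants F` via
  `geomEmb F`) under `e_A`; both inclusions are GB-06's geometric base-change lemma `isInftyKappaCoricIn_map_of_isAlgClosed`
  along `D.geomConstantsEquiv : Fbar ≃ geomConstants F` and its inverse, the loci matching by GB-04's `critMap_critLocusAt`;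
  set forms `infKappaSet_eq_preimage`, `image_infKappaSet`;
* `R.infKappaSet` is `G_A^{rat}`-STABLE (transport of GB-02's `smul_mem_minfkSet` through `reconIdentification_smul`) and
  **`D.reconInfKappaCoricPair R : CoricPair R.ratGal`** — `G_A^{rat} ↷ 𝕄_{∞κ}(Λ_A)` by GB-01's `CoricPair.ofStableSet` BY NAME
  (the `InfKappaLink.globInfk` SHAPE for GB-14), a pseudo-monoid; carrier bijection `R.infKappaCarrierEquiv` onto
  `D.critLocus.minfkSet`, `ρ_A`-equivariant and multiplicative (`coe_infKappaCarrierEquiv_smul/_mul`);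
* transport schemata for the producer (GB-14): `mapsTo_comp_reconIdentification`, `smul_comp_reconIdentification`.

HONEST LABELS (crit-A costume test 21:22:11Z; #342 (A); #343 (A)).  (1) `R.infKappaSet` and `D.reconInfKappaCoricPair R`
are **TRANSPORTED, NOT RECONSTRUCTED**: the `F̄(t)`-structure on `K_A` is the CHOSEN comparison isomorphism `φ_A`
(`Classical.choice` from `Thm_1_9`'s bare `Nonempty (… ≃+* F̄(t))`), so the `∞κ`-coric predicate on `Λ_A` carries the
provenance of the abstract field only; the identification theorem is a compatibility of OUR vocabularies (GB-01/GB-02/GB-04/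
GB-06) under `e_A`, proved for EVERY `R`, with no content about `Π_{C_F}` beyond file 1.  (2) `ReconEquivariant` is where
the anabelian content of the C2 lane would sit (crit-A W2, ERRATA-L5 X-143: our typed `AbsTopIII.Thm_1_9` transcribes
(a)(d)(e) as EXISTENCE + transport only); it is a `def … : Prop`, never a hypothesis of any theorem here, never asserted.
(3) Decomposition groups of critical points are NOT produced here (clause (a) at `nfCurveModel` is empty; at the enriched
models they are the model's RECORDED ones, returned by hypothesis — never «reconstructed»).  (4) Definitions + elementary
theorems only: no `instance`, no notation, no axiom, no `sorry`; count-neutral; typed ≠ inhabited ≠ proved-in-print;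
nothing here asserts that abc is proved or refuted.
-/

noncomputable section

namespace Literature.IUT.HodgeTheaters

open Polynomial
open scoped Pointwise
open Literature.AnabelianGeometry.AbsoluteAnabelian
open Literature.AnabelianGeometry.AbsoluteAnabelian.AbsTopIII
open Literature.FieldTheory.FunctionField

universe u

namespace InitialThetaData

variable {F K Fbar : Type u} [Field F] [NumberField F] [Field K] [NumberField K] [Algebra F K]
  [Field Fbar] [Algebra F Fbar] [Algebra K Fbar] {E : WeierstrassCurve F} [E.IsElliptic] {l : ℕ}
  {Pb : BadPlacePredicates K} (D : InitialThetaData F K Fbar E l Pb)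

/-! ### 1. Projections: the reconstruction data from the binder at the ENRICHED models -/

/-- Convenience witness (OFF the statement path, RULINGS #343 (A)(2)): the reconstruction data for `D.nfCurveModel`
from the binder at the POINTS-ENRICHED model `D.nfCurveModelOfPoints N` (GB-07's `thm_1_9_nfCurveModel_of_points`:
truncate the point output — nothing smuggled). ([IUTchI] Ex 5.1 (i) p.124) [claim: Mochizuki2012, status: disputed] -/
def reconRatObjectsOfPoints (N : D.NFPointData) (h : Thm_1_9 (D.nfCurveModelOfPoints N)) : D.ReconRatObjects :=
  D.reconRatObjects (D.thm_1_9_nfCurveModel_of_points N h)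

/-- Convenience witness (OFF the statement path): the reconstruction data from the binder
`(h₁₉ : Thm_1_9 (D.nfCurveModelLocal G))` at GB-13's ENRICHED model (global curves with NF-points ⊕ local curves),
through GB-13's projection `thm_1_9_nfCurveModel_of_local` — the form in which the C2 producer (GB-14) binds `h₁₉` BY
NAME (C2 lane wording of record, RULINGS #343 (A)(2)). ([IUTchI] Ex 5.1 (i) p.124) [claim: Mochizuki2012, status: disputed] -/
def reconRatObjectsOfLocal (G : D.LocalThetaGeometry) (h : Thm_1_9 (D.nfCurveModelLocal G)) : D.ReconRatObjects :=
  D.reconRatObjects (D.thm_1_9_nfCurveModel_of_local G h)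

/-! ### 2. The `Π_{C_F}`-action on `K_A` through `A.map`, and the residual `ReconEquivariant` (typed only) -/

namespace ReconRatObjects

variable {D} (R : D.ReconRatObjects)

/-- **`g · (−) : K_A ≃+* K_A` for `g ∈ Π_{C_F}`** — the action of the arithmetic fundamental group on the Thm-1.9 output
through the algorithm's transport `A.map` along the INNER isomorphism `innerIso g : (Π_{C_F} ↠ G_F) ≅ (Π_{C_F} ↠ G_F)`
(conjugation by `g`, by `aug g` on `G_F`): the typed functoriality (t1) of `NFPortionAlgorithm` («transport along
isomorphisms of extensions», [AbsTopIII] Thm 1.9 p. 38).  Print's «natural `π₁(†𝒟^⊛)`-action» on `†𝕄^⊛`.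
([IUTchI] Ex 5.1 (i) p.124) [claim: Mochizuki2012, status: disputed] -/
def act (g : D.geom.extF.arith) : R.funField ≃+* R.funField := (R.alg.map (D.geom.extF.innerIso g)).funEquiv

/-- `g · (−)` is the `funEquiv` component of `A.map (innerIso g)` (unfolding). ([IUTchI] Ex 5.1 (i) p.124)
[claim: Mochizuki2012, status: disputed] -/
theorem act_apply (g : D.geom.extF.arith) (x : R.funField) :
    R.act g x = (R.alg.map (D.geom.extF.innerIso g)).funEquiv x := rfl

end ReconRatObjects

/-- **`InitialThetaData.ReconEquivariant R` — TYPED ONLY, ASSERTED BY NOBODY** (RULINGS #342 (A)): the `Π_{C_F}`-action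
on the Thm-1.9 output `K_A` (through `A.map` of inner isomorphisms, `R.act`) is compatible, under the chosen comparison
isomorphism `φ_A : K_A ≃+* F̄(t)`, with the COEFFICIENT action of `G_F = Gal(F̄/F)` on `F̄(t)` through the augmentation
`Π_{C_F} ↠ G_F` (`D.augGF g = galIso (aug g)`): `φ_A (g · x) = (φ_A x)^{augGF g}`.  This is print's [AbsTopIII] Thm 1.9
FUNCTORIALITY clause at the model; our typed `AbsTopIII.Thm_1_9` (`Reconstruction.lean` :164–170) transcribes
(a)(d)(e) as EXISTENCE only — typed ≠ proved-in-print.  Where the anabelian content of the C2 lane sits (crit-A W2,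
ERRATA-L5 X-143: admissible downstream ONLY as a DECLARED RESIDUAL «h₁₉ + h₁₉-funct», never a hypothesis of a theorem
sold as proved compatibility); NOT used by any declaration of this file. ([IUTchI] Ex 5.1 (i) p.124)
[claim: Mochizuki2012, status: disputed] -/
def ReconEquivariant (R : D.ReconRatObjects) : Prop :=
  ∀ (g : D.geom.extF.arith) (x : R.funField),
    R.funFieldEquiv (R.act g x) = ratFuncMapCoeffs (D.augGF g : Fbar →+* Fbar) (R.funFieldEquiv x)

/-! ### 3. Matching the loci of the two vocabularies (`Fbar` versus `geomConstants F`) -/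

/-- GB-04's geometric locus transported along `D.geomConstantsEquiv : Fbar ≃ geomConstants F` IS the `F`-rational locus
read over the geometric constants (`D.critLocus.toGeom`, over which GB-02's `minfkSet` counts divisors): the loci of the
two vocabularies MATCH (`critMap_critLocusAt`). ([IUTchI] Rmk 3.1.7 (i) p.66) [claim: Mochizuki2012, status: disputed] -/
theorem critMap_critLocusGeom_geomConstantsEquiv :
    D.critLocusGeom.critMap (D.geomConstantsEquiv : Fbar →+* CriticalLocus.geomConstants F) = D.critLocus.toGeom := by
  rw [← D.critLocusAt_eq_critLocusGeom, D.critMap_critLocusAt Fbar (CriticalLocus.geomConstants F)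
    (D.geomConstantsEquiv : Fbar →+* CriticalLocus.geomConstants F) (RingHom.ext fun a => by simp)]
  rfl

/-- … and back: `D.critLocus.toGeom` transported along `geomConstantsEquiv⁻¹` is `D.critLocusGeom`.
([IUTchI] Rmk 3.1.7 (i) p.66) [claim: Mochizuki2012, status: disputed] -/
theorem critMap_toGeom_geomConstantsEquiv_symm :
    D.critLocus.toGeom.critMap (D.geomConstantsEquiv.symm : CriticalLocus.geomConstants F →+* Fbar) = D.critLocusGeom := by
  rw [← D.critMap_critLocusGeom_geomConstantsEquiv, CriticalLocus.critMap_critMap,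
    show (D.geomConstantsEquiv.symm : CriticalLocus.geomConstants F →+* Fbar).comp
        (D.geomConstantsEquiv : Fbar →+* CriticalLocus.geomConstants F) = RingHom.id Fbar from
      RingHom.ext fun x => by simp,
    CriticalLocus.critMap_id]

/-- The constant-field extension along an identity is the identity (from GB-06's characterisation
`ratFuncHom_eq_ratFuncMapCoeffs`). ([IUTchI] Rmk 3.1.7 (i) p.66) [claim: Mochizuki2012, status: disputed] -/
theorem ratFuncMapCoeffs_id_apply {Ω : Type u} [Field Ω] (g : RatFunc Ω) : ratFuncMapCoeffs (RingHom.id Ω) g = g := by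
  rw [← CriticalLocus.ratFuncHom_eq_ratFuncMapCoeffs (RingHom.id Ω) (RingHom.id (RatFunc Ω)) (fun _ => rfl) rfl]
  rfl

/-! ### 4. The `∞κ`-coric elements of `Λ_A` at GB-04's geometric locus (transported structure) -/

namespace ReconRatObjects

variable {D} (R : D.ReconRatObjects)

/-- The `F̄(t)`-algebra structure on `Λ_A`: `F̄(t) ≅ K_A → Λ_A` through `φ_A⁻¹` (label (1): TRANSPORTED along the chosen
`φ_A`).  A DEFINITION, not an instance; bind with `letI`. ([IUTchI] Ex 5.1 (i) p.124) [claim: Mochizuki2012, status: disputed] -/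
@[reducible] def geomAlgebra : Algebra (RatFunc Fbar) R.ratClosure :=
  ((algebraMap R.funField R.ratClosure).comp (R.funFieldEquiv.symm : RatFunc Fbar →+* R.funField)).toAlgebra

/-- Unfolding of the structure map `F̄(t) → Λ_A`. ([IUTchI] Ex 5.1 (i) p.124) [claim: Mochizuki2012, status: disputed] -/
theorem geomAlgebra_algebraMap_apply (g : RatFunc Fbar) :
    letI := R.geomAlgebra
    algebraMap (RatFunc Fbar) R.ratClosure g = algebraMap R.funField R.ratClosure (R.funFieldEquiv.symm g) := rfl

/-- `e_A` on the structure map `F̄(t) → Λ_A` is the model embedding `θ : F̄(t) ↪ Λ_F` of file 1.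
([IUTchI] Ex 5.1 (i) p.124) [claim: Mochizuki2012, status: disputed] -/
theorem reconIdentification_geomAlgebraMap (g : RatFunc Fbar) :
    letI := R.geomAlgebra
    D.reconIdentification R (algebraMap (RatFunc Fbar) R.ratClosure g) = D.nfRatEmb g := by
  rw [geomAlgebra_algebraMap_apply, reconIdentification_algebraMap, RingEquiv.apply_symm_apply]

variable [CharZero Fbar]

/-- **`𝕄_{∞κ}(Λ_A) ⊆ Λ_A`** — the `∞κ`-coric elements of the Thm-1.9-presented closure: GB-01's
`CriticalLocus.infKappaCoricSetIn` BY NAME at GB-04's GEOMETRIC strictly critical locus `D.critLocusGeom : CriticalLocus Fbar`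
BY NAME, for the (transported) structure `R.geomAlgebra` — «`fⁿ` is a `κ`-coric element» with divisors counted over `F̄`
(Rmk 3.1.7 (ii); RULINGS #318).  Label (1): TRANSPORTED, not reconstructed. ([IUTchI] Ex 5.1 (i) p.124)
[claim: Mochizuki2012, status: disputed] -/
def infKappaSet : Set R.ratClosure :=
  letI := R.geomAlgebra
  D.critLocusGeom.infKappaCoricSetIn R.ratClosure

/-- Membership in `𝕄_{∞κ}(Λ_A)`, unfolded: `xⁿ = φ_A⁻¹ g` in `Λ_A` for some `n ≥ 1` and some `κ`-coric `g ∈ F̄(t)` for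
`D.critLocusGeom`. ([IUTchI] Rmk 3.1.7 (ii) p.67) [claim: Mochizuki2012, status: disputed] -/
theorem mem_infKappaSet_iff (x : R.ratClosure) :
    x ∈ R.infKappaSet ↔ ∃ n : ℕ, 0 < n ∧ ∃ g : RatFunc Fbar, D.critLocusGeom.IsKappaCoric g ∧
      x ^ n = algebraMap R.funField R.ratClosure (R.funFieldEquiv.symm g) :=
  Iff.rfl

/-- `0 ∉ 𝕄_{∞κ}(Λ_A)` (GB-01's `zero_notMem_infKappaCoricSetIn`). ([IUTchI] Rmk 3.1.7 (ii) p.67)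
[claim: Mochizuki2012, status: disputed] -/
theorem zero_notMem_infKappaSet : (0 : R.ratClosure) ∉ R.infKappaSet :=
  letI := R.geomAlgebra
  D.critLocusGeom.zero_notMem_infKappaCoricSetIn

/-- `1 ∈ 𝕄_{∞κ}(Λ_A)` (GB-01's `one_mem_infKappaCoricSetIn`). ([IUTchI] Rmk 3.1.7 (ii) p.67)
[claim: Mochizuki2012, status: disputed] -/
theorem one_mem_infKappaSet : (1 : R.ratClosure) ∈ R.infKappaSet :=
  letI := R.geomAlgebra
  D.critLocusGeom.one_mem_infKappaCoricSetIn

/-- **`𝕄_{∞κ}(Λ_A)` is not reduced to roots of unity**: it contains the image of a NON-CONSTANT `κ`-coric function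
(GB-04's Rmk 3.1.7 (ii) witness at the datum's locus, `exists_isInftyKappaCoricIn_critLocusGeom`, read through
`R.geomAlgebra`). ([IUTchI] Rmk 3.1.7 (ii) p.67) [claim: Mochizuki2012, status: disputed] -/
theorem exists_mem_infKappaSet_ne_C :
    ∃ f : RatFunc Fbar, algebraMap R.funField R.ratClosure (R.funFieldEquiv.symm f) ∈ R.infKappaSet ∧
      ∀ c : Fbar, f ≠ RatFunc.C c := by
  letI := R.geomAlgebra
  exact D.exists_isInftyKappaCoricIn_critLocusGeom R.ratClosure

/-! ### 5. The identification carries `𝕄_{∞κ}(Λ_A)` onto the model carrier `𝕄_{∞κ}(Λ_F) = D.critLocus.minfkSet` -/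

/-- **`e_A (𝕄_{∞κ}(Λ_A)) ⊆ 𝕄_{∞κ}(Λ_F)`**: GB-06's geometric base-change lemma along `Fbar ≃ geomConstants F` and the
`F̄(t)`-compatible `e_A` (`reconIdentification_geomAlgebraMap`: `e_A` restricted to `F̄(t)` is `θ = geomEmb ∘ (·)^{ι}`).
([IUTchI] Ex 5.4 (iv) p.149) [claim: Mochizuki2012, status: disputed] -/
theorem reconIdentification_mem_minfkSet {x : R.ratClosure} (hx : x ∈ R.infKappaSet) :
    D.reconIdentification R x ∈ D.critLocus.minfkSet := by
  letI := R.geomAlgebra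
  letI : Algebra (RatFunc (CriticalLocus.geomConstants F)) (RatAlgClosure F) :=
    (CriticalLocus.geomEmb F).toRingHom.toAlgebra
  haveI := D.isAlgClosure
  haveI : IsAlgClosed Fbar := IsAlgClosure.isAlgClosed F
  have hS : D.critLocus.toGeom.pts = D.critLocusGeom.pts.map
      ⟨(D.geomConstantsEquiv : Fbar →+* CriticalLocus.geomConstants F),
        (D.geomConstantsEquiv : Fbar →+* CriticalLocus.geomConstants F).injective⟩ := by
    rw [← D.critMap_critLocusGeom_geomConstantsEquiv]; rfl
  exact CriticalLocus.isInftyKappaCoricIn_map_of_isAlgClosed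
    (D.geomConstantsEquiv : Fbar →+* CriticalLocus.geomConstants F) hS (D.reconIdentification R).toRingHom
    (fun g => by
      rw [RingEquiv.toRingHom_eq_coe, RingEquiv.coe_toRingHom, reconIdentification_geomAlgebraMap]; rfl) hx

/-- **`e_A⁻¹ (𝕄_{∞κ}(Λ_F)) ⊆ 𝕄_{∞κ}(Λ_A)`**: the same lemma along `geomConstantsEquiv⁻¹` (the geometric constants
`geomConstants F` are algebraically closed, GB-03's `isAlgClosed_geomConstants`) and `e_A⁻¹`.
([IUTchI] Ex 5.4 (iv) p.149) [claim: Mochizuki2012, status: disputed] -/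
theorem reconIdentification_symm_mem_infKappaSet {y : RatAlgClosure F} (hy : y ∈ D.critLocus.minfkSet) :
    (D.reconIdentification R).symm y ∈ R.infKappaSet := by
  letI := R.geomAlgebra
  letI : Algebra (RatFunc (CriticalLocus.geomConstants F)) (RatAlgClosure F) :=
    (CriticalLocus.geomEmb F).toRingHom.toAlgebra
  haveI : IsAlgClosed (CriticalLocus.geomConstants F) := RatBaseChange.isAlgClosed_geomConstants
  have hS : D.critLocusGeom.pts = D.critLocus.toGeom.pts.map
      ⟨(D.geomConstantsEquiv.symm : CriticalLocus.geomConstants F →+* Fbar),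
        (D.geomConstantsEquiv.symm : CriticalLocus.geomConstants F →+* Fbar).injective⟩ := by
    rw [← D.critMap_toGeom_geomConstantsEquiv_symm]; rfl
  refine CriticalLocus.isInftyKappaCoricIn_map_of_isAlgClosed
    (D.geomConstantsEquiv.symm : CriticalLocus.geomConstants F →+* Fbar) hS (D.reconIdentification R).symm.toRingHom
    (fun g => ?_) hy
  rw [RingEquiv.toRingHom_eq_coe, RingEquiv.coe_toRingHom]
  apply (D.reconIdentification R).injective
  rw [RingEquiv.apply_symm_apply, reconIdentification_geomAlgebraMap, nfRatEmb, RingHom.comp_apply,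
    ratFuncMapCoeffs_ratFuncMapCoeffs,
    show (D.geomConstantsEquiv : Fbar →+* CriticalLocus.geomConstants F).comp
        (D.geomConstantsEquiv.symm : CriticalLocus.geomConstants F →+* Fbar) =
        RingHom.id (CriticalLocus.geomConstants F) from RingHom.ext fun x => by simp,
    ratFuncMapCoeffs_id_apply]
  rfl

/-- **IDENTIFICATION THEOREM**: `e_A x ∈ 𝕄_{∞κ}(Λ_F) ↔ x ∈ 𝕄_{∞κ}(Λ_A)` — the transported `∞κ`-coric structure on the
Thm-1.9-presented closure IS GB-02's model carrier `D.critLocus.minfkSet` (design (B)) under the identification, for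
EVERY `R`. ([IUTchI] Ex 5.1 (i) p.124) [claim: Mochizuki2012, status: disputed] -/
theorem reconIdentification_mem_minfkSet_iff (x : R.ratClosure) :
    D.reconIdentification R x ∈ D.critLocus.minfkSet ↔ x ∈ R.infKappaSet :=
  ⟨fun h => by simpa using R.reconIdentification_symm_mem_infKappaSet h, R.reconIdentification_mem_minfkSet⟩

/-- Set form: `𝕄_{∞κ}(Λ_A) = e_A⁻¹ (𝕄_{∞κ}(Λ_F))`. ([IUTchI] Ex 5.1 (i) p.124) [claim: Mochizuki2012, status: disputed] -/
theorem infKappaSet_eq_preimage : R.infKappaSet = D.reconIdentification R ⁻¹' D.critLocus.minfkSet :=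
  Set.ext fun x => (R.reconIdentification_mem_minfkSet_iff x).symm

/-- Set form: `e_A (𝕄_{∞κ}(Λ_A)) = 𝕄_{∞κ}(Λ_F)`. ([IUTchI] Ex 5.1 (i) p.124) [claim: Mochizuki2012, status: disputed] -/
theorem image_infKappaSet : D.reconIdentification R '' R.infKappaSet = D.critLocus.minfkSet := by
  rw [infKappaSet_eq_preimage, Set.image_preimage_eq _ (D.reconIdentification R).surjective]

/-! ### 6. `G_A^{rat} ↷ 𝕄_{∞κ}(Λ_A)` as a `CoricPair` (the `globInfk` shape) and its identification with the model pair -/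

/-- **`𝕄_{∞κ}(Λ_A)` is `G_A^{rat}`-stable**: transport of GB-02's `smul_mem_minfkSet` (stability of the model carrier under
`G_F^{rat}`) through the by-construction equivariance `e_A (σ • x) = ρ_A(σ) • e_A x` of file 1 (`ρ_A` = conjugation by
`e_A`; «Galois-compatible BY TRANSPORT»). ([IUTchI] Ex 5.1 (i) p.124) [claim: Mochizuki2012, status: disputed] -/
theorem smul_mem_infKappaSet (σ : R.ratGal) {x : R.ratClosure} (hx : x ∈ R.infKappaSet) : σ • x ∈ R.infKappaSet := by
  rw [← reconIdentification_mem_minfkSet_iff, reconIdentification_smul]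
  exact D.critLocus.smul_mem_minfkSet _ ((R.reconIdentification_mem_minfkSet_iff x).mpr hx)

end ReconRatObjects

/-- **`G_A^{rat} ↷ 𝕄_{∞κ}(Λ_A)`** — the `∞κ`-coric pseudo-monoid of the Thm-1.9-presented closure with its continuous
`G_A^{rat}`-action, as abc-iut-L5-t1's t1 `CoricPair` by GB-01's `CoricPair.ofStableSet` BY NAME (carrier `R.infKappaSet`,
partial multiplication = that of `Λ_A`, open stabilisers for the Krull topology since `Λ_A / F(t)` is integral): the SHAPE of
`InfKappaLink.globInfk` at the reconstruction presentation (for GB-14).  Label (1): TRANSPORTED structure; identified with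
GB-10's model pair `D.critLocus.minfkCoricPair` on carriers by `infKappaCarrierEquiv`. ([IUTchI] Ex 5.1 (v) p.127)
[claim: Mochizuki2012, status: disputed] -/
abbrev reconInfKappaCoricPair [CharZero Fbar] (R : D.ReconRatObjects) : CoricPair R.ratGal :=
  letI := R.funFieldAlgebra
  haveI := R.isIntegral_ratClosure
  CoricPair.ofStableSet (RatFunc F) R.ratClosure R.infKappaSet (fun σ _ hx => R.smul_mem_infKappaSet σ hx)

namespace ReconRatObjects

variable {D} [CharZero Fbar] (R : D.ReconRatObjects)

/-- The action on the pair is the Galois action of `G_A^{rat}` on `Λ_A`. ([IUTchI] Ex 5.1 (v) p.127)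
[claim: Mochizuki2012, status: disputed] -/
@[simp] theorem coe_smul_reconInfKappaCoricPair (σ : R.ratGal) (x : (D.reconInfKappaCoricPair R).carrier) :
    ((σ • x : (D.reconInfKappaCoricPair R).carrier) : R.ratClosure) = σ (x : R.ratClosure) := rfl

/-- Elements of the pair are `∞κ`-coric elements of `Λ_A`. ([IUTchI] Ex 5.1 (v) p.127) [claim: Mochizuki2012, status: disputed] -/
theorem coe_mem_infKappaSet (x : (D.reconInfKappaCoricPair R).carrier) : (x : R.ratClosure) ∈ R.infKappaSet := x.2

/-- The pair IS a pseudo-monoid ([IUTchI] §0 p. 33), realised in `Λ_A^×` (`0 ∉ 𝕄_{∞κ}(Λ_A)`).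
([IUTchI] Ex 5.1 (v) p.127) [claim: Mochizuki2012, status: disputed] -/
theorem isPseudoMonoid_reconInfKappaCoricPair : (D.reconInfKappaCoricPair R).pm.IsPseudoMonoid :=
  letI := R.funFieldAlgebra
  haveI := R.isIntegral_ratClosure
  CoricPair.isPseudoMonoid_ofStableSet _ R.zero_notMem_infKappaSet

/-- **Carrier identification**: `e_A` restricts to a bijection `𝕄_{∞κ}(Λ_A) ≃ 𝕄_{∞κ}(Λ_F)` of the carrier of the
reconstruction-presented pair with the carrier of GB-10's design-(B) global pair `D.critLocus.minfkCoricPair`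
(`= CoricPair.ofStableSet (RatFunc F) (RatAlgClosure F) D.critLocus.minfkSet _`, the `globInfk` of `infKappaLinkArith`).
([IUTchI] Ex 5.1 (v) p.127) [claim: Mochizuki2012, status: disputed] -/
def infKappaCarrierEquiv : (D.reconInfKappaCoricPair R).carrier ≃ D.critLocus.minfkCoricPair.carrier :=
  (D.reconIdentification R).toEquiv.subtypeEquiv fun x => (R.reconIdentification_mem_minfkSet_iff x).symm

/-- `infKappaCarrierEquiv` is `e_A` on elements. ([IUTchI] Ex 5.1 (v) p.127) [claim: Mochizuki2012, status: disputed] -/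
@[simp] theorem coe_infKappaCarrierEquiv (x : (D.reconInfKappaCoricPair R).carrier) :
    ((R.infKappaCarrierEquiv x : D.critLocus.minfkCoricPair.carrier) : RatAlgClosure F) = D.reconIdentification R x := rfl

/-- `infKappaCarrierEquiv⁻¹` is `e_A⁻¹` on elements. ([IUTchI] Ex 5.1 (v) p.127) [claim: Mochizuki2012, status: disputed] -/
@[simp] theorem coe_infKappaCarrierEquiv_symm (y : D.critLocus.minfkCoricPair.carrier) :
    ((R.infKappaCarrierEquiv.symm y : (D.reconInfKappaCoricPair R).carrier) : R.ratClosure) =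
      (D.reconIdentification R).symm y := rfl

/-- **Equivariance of the carrier identification — «Galois-compatible BY TRANSPORT»** (by construction of `ρ_A` as
conjugation by `e_A`; content-free API, never to be cited as provenance, crit-A 21:38:38Z (2)): `E (σ • x) = ρ_A(σ) • E x`
for the two pairs' own actions (the `CoricPair.Iso.smul` shape along `ρ_A`). ([IUTchI] Ex 5.1 (v) p.127)
[claim: Mochizuki2012, status: disputed] -/
theorem infKappaCarrierEquiv_smul (σ : R.ratGal) (x : (D.reconInfKappaCoricPair R).carrier) :
    R.infKappaCarrierEquiv (σ • x) = D.reconRatGalEquiv R σ • R.infKappaCarrierEquiv x := by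
  letI := R.funFieldAlgebra
  apply Subtype.ext
  rw [coe_infKappaCarrierEquiv, CriticalLocus.coe_smul_minfkCoricPair, coe_infKappaCarrierEquiv,
    coe_smul_reconInfKappaCoricPair, ← AlgEquiv.smul_def, ← AlgEquiv.smul_def, reconIdentification_smul]

/-- **The domains of the two partial multiplications correspond** under `E` (the `CoricPair.Iso.dom` shape): a pair of
`∞κ`-coric elements of `Λ_A` has `∞κ`-coric product iff its `e_A`-image does (`e_A` is a ring isomorphism).
([IUTchI] Ex 5.1 (v) p.127) [claim: Mochizuki2012, status: disputed] -/
theorem mem_dom_iff_infKappaCarrierEquiv (p : (D.reconInfKappaCoricPair R).carrier × (D.reconInfKappaCoricPair R).carrier) :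
    p ∈ (D.reconInfKappaCoricPair R).pm.dom ↔
      (R.infKappaCarrierEquiv p.1, R.infKappaCarrierEquiv p.2) ∈ D.critLocus.minfkCoricPair.pm.dom := by
  change (p.1 : R.ratClosure) * p.2 ∈ R.infKappaSet ↔
    D.reconIdentification R (p.1 : R.ratClosure) * D.reconIdentification R (p.2 : R.ratClosure) ∈ D.critLocus.minfkSet
  rw [← map_mul, reconIdentification_mem_minfkSet_iff]

/-- **`E` respects the partial multiplications** (the `CoricPair.Iso.op` shape): `E (x · y) = E x · E y` on the domain.
([IUTchI] Ex 5.1 (v) p.127) [claim: Mochizuki2012, status: disputed] -/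
theorem infKappaCarrierEquiv_op (p : (D.reconInfKappaCoricPair R).pm.dom) :
    R.infKappaCarrierEquiv ((D.reconInfKappaCoricPair R).pm.op p) =
      D.critLocus.minfkCoricPair.pm.op ⟨(R.infKappaCarrierEquiv p.1.1, R.infKappaCarrierEquiv p.1.2),
        (R.mem_dom_iff_infKappaCarrierEquiv p.1).mp p.2⟩ :=
  Subtype.ext (map_mul (D.reconIdentification R) (p.1.1 : R.ratClosure) p.1.2)

/-- The `G_A^{rat}`-FIXED elements of the pair are exactly those in (the image of) `F(t)`: print's «`𝕄_κ` = the
`π₁^{rat}`-invariants of `𝕄_{∞κ}`» mechanism at the reconstruction presentation (GB-01's `forall_smul_eq_iff_ofStableSet`,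
`Λ_A / F(t)` Galois). ([IUTchI] Ex 5.1 (i) p.124) [claim: Mochizuki2012, status: disputed] -/
theorem forall_smul_eq_iff_reconInfKappaCoricPair (x : (D.reconInfKappaCoricPair R).carrier) :
    (∀ σ : R.ratGal, σ • x = x) ↔
      letI := R.funFieldAlgebra; (x : R.ratClosure) ∈ Set.range (algebraMap (RatFunc F) R.ratClosure) := by
  letI := R.funFieldAlgebra
  haveI := R.isIntegral_ratClosure
  haveI := R.isGalois_ratClosure
  exact CoricPair.forall_smul_eq_iff_ofStableSet x

/-! ### 7. Transport schemata for the producer (GB-14): composing the model's restriction data with `e_A` -/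

/-- **Membership transport**: if a map `ι` out of `Λ_F` (e.g. GB-03's `ι_v`, the restriction of Kummer classes) carries the
model carrier `𝕄_{∞κ}(Λ_F)` into a set `M'` (clause (a) at the model, GB-06/GB-12), then `ι ∘ e_A` carries `𝕄_{∞κ}(Λ_A)`
into `M'`. ([IUTchI] Ex 5.4 (iv) p.149) [claim: Mochizuki2012, status: disputed] -/
theorem mapsTo_comp_reconIdentification {Λ' : Type*} {ι : RatAlgClosure F → Λ'} {M' : Set Λ'}
    (h : Set.MapsTo ι D.critLocus.minfkSet M') :
    Set.MapsTo (ι ∘ D.reconIdentification R) R.infKappaSet M' :=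
  fun _ hx => h (R.reconIdentification_mem_minfkSet hx)

omit [CharZero Fbar] in
/-- **Equivariance transport**: if `ι` out of `Λ_F` is equivariant along a homomorphism `r : Γ → G_F^{rat}` (clauses (b)(c)
at the model: GB-03's `iota_ratHom_smul`), then `ι ∘ e_A` is equivariant along `ρ_A⁻¹ ∘ r : Γ → G_A^{rat}`.
([IUTchI] Ex 5.4 (iv) p.149) [claim: Mochizuki2012, status: disputed] -/
theorem smul_comp_reconIdentification {Γ Λ' : Type*} [SMul Γ Λ'] {ι : RatAlgClosure F → Λ'} {r : Γ → RatGal F}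
    (h : ∀ (γ : Γ) (y : RatAlgClosure F), ι (r γ • y) = γ • ι y) (γ : Γ) (x : R.ratClosure) :
    (ι ∘ D.reconIdentification R) ((D.reconRatGalEquiv R).symm (r γ) • x) = γ • (ι ∘ D.reconIdentification R) x := by
  rw [Function.comp_apply, Function.comp_apply, reconIdentification_smul, ContinuousMulEquiv.apply_symm_apply, h]

end ReconRatObjects

end InitialThetaData

end Literature.IUT.HodgeTheaters

end
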